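import Summits.AnomalousDissipation.AnomalousDissipation.Theses.ImpulseGrid
import Literature.Analysis.FluidPDE.LinearizedNSTorus
import Literature.Analysis.FluidPDE.TorusClassicalLerayHopfProofs

/-!
# Sketch (crux-ideate, ideator 1, round 1) — crux `ImpulseGrid.BoundedEnergyGrid`
(stmt-AnomalousDissipation-10430): the DRIFT LIFT of the planar zero-momentum programme.

First lemmas of idea card `drift-lift-planar-inertial-branch`: the unit-mass profile `Φ ≡ 1` is a
legal design, the drift is then a Galilean boost of an `x₀`-independent problem, and every planar
zero-momentum witness `v_j` on `T²` (steady branch C⁺, or Leray–Hopf family) lifts to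
`u_j := c e₀ + ι(v_j ∘ π)` — a global Leray–Hopf family on `T³` with drift data `∫u₀ = c e₀` and
`meanEnergy (u_j) = c² + meanEnergy (v_j)`.  Statements only (sorried); they elaborate.
-/

noncomputable section

namespace Summit.AnomalousDissipation.AnomalousDissipation.Cruxes.BoundedEnergyGrid.DriftLift

open MeasureTheory Filter Topology
open Literature.Analysis.FunctionSpaces Literature.Analysis.FunctionSpaces.Torus
open Literature.Analysis.FluidPDE Literature.Analysis.FluidPDE.Torus
open Summit.AnomalousDissipation.AnomalousDissipation.Theses.ImpulseGrid

/-- The flat two-torus (transverse plane). -/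
local notation "𝕋²" => UnitAddTorus (Fin 2)
/-- Planar velocity values. -/
local notation "E²" => EuclideanSpace ℝ (Fin 2)
/-- The flat three-torus. -/
local notation "𝕋³" => UnitAddTorus (Fin 3)
/-- Velocity values on `T³`. -/
local notation "E³" => EuclideanSpace ℝ (Fin 3)

/-- **C⁺ (planar, steady): bounded steady branch at fixed force and zero momentum** — verbatim shape of
`BoundedSteadyBranch` of the planar crux programme (Cruxes/TwodBoundedEnergyZeroMomentum/Lines/*):
one smooth divergence-free mean-zero `g ≠ 0` on `T²`, `ν_j → 0`, smooth MEAN-ZERO steady states of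
`NS_{ν_j}(g)` with `∫‖v_j‖²` bounded (Constantin–Tarfulea–Vicol 2013, p. 3: open). -/
def PlanarBoundedSteadyBranch : Prop :=
  ∃ g : 𝕋² → E², IsSmooth g ∧ IsDivFree g ∧ HasZeroMean g ∧ g ≠ 0 ∧
    ∃ (ν : ℕ → ℝ) (v : ℕ → 𝕋² → E²) (p : ℕ → 𝕋² → ℝ),
      (∀ j, 0 < ν j) ∧ Tendsto ν atTop (𝓝 0) ∧
      (∀ j, IsSteadyNSState (ν j) g (v j) (p j)) ∧
      (∀ j, HasZeroMean (v j)) ∧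
      ∃ E : ℝ, ∀ j, ∫ x, ‖v j x‖ ^ 2 ≤ E

/-- **C⁺ (planar, Leray–Hopf form)** — the shape of the (dropped) planar crux
`TwoAndHalfD.TwodBoundedEnergyZeroMomentum` (stmt-AnomalousDissipation-10786): a zero-momentum planar
Leray–Hopf family under one fixed `g ≠ 0` with bounded limsup-mean energy. -/
def PlanarBoundedEnergyZeroMomentum : Prop :=
  ∃ g : 𝕋² → E², IsSmooth g ∧ IsDivFree g ∧ HasZeroMean g ∧ g ≠ 0 ∧
    ∃ (ν : ℕ → ℝ) (v₀ : ℕ → 𝕋² → E²) (v : ℕ → ℝ → 𝕋² → E²),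
      (∀ j, 0 < ν j) ∧ Tendsto ν atTop (𝓝 0) ∧
      (∀ j, IsGlobalLerayHopf (ν j) (fun _ => g) (v₀ j) (v j)) ∧
      (∀ j, HasZeroMean (v₀ j)) ∧
      ∃ E : ℝ, ∀ j, meanEnergy (v j) ≤ E

/-- Drop the drift coordinate: `T³ → T²`, `(x₀,x₁,x₂) ↦ (x₁,x₂)`. -/
def proj (x : 𝕋³) : 𝕋² := fun i => x i.succ

/-- Embed planar vectors into the transverse plane `{w₀ = 0}` of `E³`. -/
def embed (w : E²) : E³ := ∑ i : Fin 2, w i • EuclideanSpace.single i.succ (1 : ℝ)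

/-- The drift lift of a planar field: `u = c e₀ + ι(v ∘ π)`. -/
def driftLift (c : ℝ) (v : 𝕋² → E²) : 𝕋³ → E³ :=
  fun x => c • EuclideanSpace.single (0 : Fin 3) (1 : ℝ) + embed (v (proj x))

/-- **Lemma 1 (energy bookkeeping of the lift).** For a mean-zero planar field the lifted energy splits:
`∫‖c e₀ + ι v‖² = c² + ∫‖v‖²` (cross term `2c∫v·e₀ = 0` because `ι v ⊥ e₀` pointwise; the torus has
volume one). -/
theorem integral_norm_sq_driftLift (c : ℝ) (v : 𝕋² → E²) (hv : MemLp v 2 volume) :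
    ∫ x, ‖driftLift c v x‖ ^ 2 = c ^ 2 + ∫ y, ‖v y‖ ^ 2 := by
  sorry

/-- **Lemma 2 (steady lift is a steady state on `T³`).** A planar steady state of `NS_ν(g)` lifts, for every
drift `c`, to a steady state of `NS_ν(ι g ∘ π)` on `T³` (the drift term `c ∂₀` annihilates `x₀`-independent
fields; pressure `p ∘ π`). -/
theorem isSteadyNSState_driftLift {ν c : ℝ} {g v : 𝕋² → E²} {p : 𝕋² → ℝ}
    (h : IsSteadyNSState ν g v p) :
    IsSteadyNSState ν (fun x => embed (g (proj x))) (driftLift c v) (fun x => p (proj x)) := by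
  sorry

/-- **First lemma of the card (steady form): the planar bounded steady branch closes the crux.**
Design `Φ ≡ 1` (unit mass because the torus is a probability space), `G := ι g ∘ π`
(`x₀`-invariant, `G·e₀ = 0`, smooth, divergence-free, mean-zero, `≠ 0`), any `c > 0`; witnesses
`u_j := c e₀ + ι(v_j ∘ π)` constant in time: classical ⇒ global Leray–Hopf
(`Torus.IsClassicalNSSolutionOn.isGlobalLerayHopf`), `∫u_j(0) = c e₀`, `meanEnergy = c² + ∫‖v_j‖² ≤ c² + E`. -/
theorem boundedEnergyGrid_of_planarBoundedSteadyBranch :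
    PlanarBoundedSteadyBranch → BoundedEnergyGrid := by
  sorry

/-- **First lemma of the card (Leray–Hopf form): the planar zero-momentum bounded-energy family closes the
crux** (same design; the lift of a planar Leray–Hopf solution with the constant third component `c` is a
Leray–Hopf solution on `T³` — the `θ ≡ c` case of the 2½-D lift, Majda–Bertozzi §2.3). -/
theorem boundedEnergyGrid_of_planarBoundedEnergyZeroMomentum :
    PlanarBoundedEnergyZeroMomentum → BoundedEnergyGrid := by
  sorry

end Summit.AnomalousDissipation.AnomalousDissipation.Cruxes.BoundedEnergyGrid.DriftLift

end
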